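import Summits.RiemannHypothesis.RiemannHypothesis.Theorems.GroundBartaEvenWinsBeyondArchDeflationArchLoc1
import Literature.Analysis.ValidatedNumerics.TaylorModelContract
import Literature.Analysis.ValidatedNumerics.TaylorModelPartial
import Literature.Analysis.ValidatedNumerics.TaylorModelSymmDiff
import Literature.Analysis.ValidatedNumerics.TaylorModelMovingIntegral
import Literature.NumberTheory.LFunctions.WeilArchDensityPanels
import Literature.NumberTheory.LFunctions.WeilArchTailPanels
import HarnessLib

/-!
# RiemannHypothesis / GroundBarta — rung 4 (`EvenWinsBeyondArch`, stmt-RiemannHypothesis-18807 / 18085):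
# the deflated Temple L-side, XVI′ — the archimedean part of the window image from LOCAL TABLES (kernel-feasible v2)

Helper file (`--supports stmt-RiemannHypothesis-18807`), RH-free, Mathlib + landed tree files only, no facts.  Prover B,
speedrun unit `sr-gb-rung-b` (gen 4).  Replaces file XVI (`dt_archSplitTM`, exact bivariate moving integrals — correct but not
kernel-evaluable at production size, R-LAYER.md §10).

For the `k`-th y-panel (`y = y_k + ρ`, `|ρ| ≤ h`, `h = c/(2m)`, `k + 2 ≤ m`) the two arch integrals of `dt_archImage_split`,

  `E(ρ) = ∫_{(0, c−y]} G(t)·(2g(y) − g(y−t) − g(y+t))/t dt`,   `H(ρ) = ∫_{(c−y, c+y]} G(t)·(g(y) − g(y−t))/t dt`,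

are enclosed by Taylor models built ONLY from: the exact local expansion of `g` at `y_k` (panel 0, `tmem_panel0`), the local
Taylor TABLE of `g` at the even grid points `2nh` (`TabOK`, contracted against the moments of `ρ(t_i + u)` on each t-panel,
`tmem_contrI`; partial panels `tmem_partVar` / `tmem_partConst`), the panel models of `ρ` and their moments.
Main results: `dt_tmem_archE`, `dt_tmem_archH`.

References: E. Bombieri, Rend. Mat. Acc. Lincei (9) 11 (2000) Thm 2 [Bombieri2000Weil]; K. Makino, M. Berz (2003).

(Part 2 of 2 of this topic; see part 1 for the overview.)
-/

set_option linter.dupNamespace false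

noncomputable section

open MeasureTheory Set Filter intervalIntegral Finset
open scoped Topology BigOperators

namespace Summit.RiemannHypothesis.RiemannHypothesis.Theorems.EvenWinsBeyondArch

open Literature.NumberTheory.LFunctions
open Literature.Analysis.ValidatedNumerics Literature.Analysis.ValidatedNumerics.PolyMP
  Literature.Analysis.ValidatedNumerics.NumericsMP Literature.Analysis.ValidatedNumerics.ExpPoly

/-! ## The H-part -/

section ArchH

variable {S : ℕ} {c : ℚ} {m k Dl : ℕ} {g : ℝ → ℝ}


/-- The Taylor model of the H-part (full panels `jn ≤ i < jf` by contraction, minus the near partial, plus the far partial). -/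
def dt_archHTM (S : ℕ) (c : ℚ) (m k Dl : ℕ) (Gy : IPoly) (tab : ℤ → IPoly × ℤ × ℤ) (mu : ℕ → List MI)
    (W : ℕ → IPoly) (pw : ℕ → Poly) : IPoly :=
  let h : ℚ := c / (2 * m)
  let jn := m - 1 - k
  let jf := m + k
  let m0 : ℕ → MI := fun i ↦ (mu i).getD 0 default
  let contrW : ℤ → ℕ → ℤ → IPoly := fun n i sgn ↦
    widen0 (contrI S (tab n).1 (mu i) sgn) ⌈(((tab n).2.1 * (m0 i).hi : ℤ) : ℚ) / S⌉
  let partVarW : ℤ → ℕ → ℤ → ℤ → IPoly := fun n i sgn τ ↦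
    widen0 (partVarI S h (tab n).1 (pw i) sgn τ)
      ⌈((((tab n).2.1 * (m0 i).hi : ℤ) : ℚ) +
        2 * h * ((tabsI S h (tsubI (W i) (ratPolyI S (pw i))) * (tab n).2.2 : ℤ) : ℚ)) / S⌉
  let full := (List.range jf).foldl (fun acc i ↦ if jn ≤ i then
      taddI acc (tsubI (tsmulI S (m0 i) Gy) (contrW ((k : ℤ) - i) i (-1))) else acc) []
  let near := tsubI (tmulI S h Dl Gy (partConstI S h (W jn) (pw jn) (-1))) (partVarW ((k : ℤ) - jn) jn (-1) (-1))
  let far := tsubI (tmulI S h Dl Gy (partConstI S h (W jf) (pw jf) 1)) (partVarW ((k : ℤ) - jf) jf (-1) 1)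
  taddI (tsubI full near) far

/-- **The H-part of the arch integral, enclosed from local tables** (same data as `dt_tmem_archE`).
[cite: Bombieri2000Weil, Thm 2 (archimedean term)] -/
theorem dt_tmem_archH (hS : 0 < S) (hc : 0 < c) (hkm : k + 2 ≤ m) (hg : Continuous g)
    {as0 : List ℝ} (hexp0 : ∀ s, g (((PolyMP.panelCentre (c / (2 * m)) k : ℚ) : ℝ) + s) = evalR as0 s)
    {Gy : IPoly} (hGy : TMem S (c / (2 * m)) (fun s ↦ g (((PolyMP.panelCentre (c / (2 * m)) k : ℚ) : ℝ) + s)) Gy)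
    {tab : ℤ → IPoly × ℤ × ℤ}
    (htab : ∀ n : ℤ, -(m : ℤ) ≤ n → n ≤ m →
      TabOK S (2 * (c / (2 * m))) (fun s ↦ g (2 * (n : ℝ) * ((c / (2 * m) : ℚ) : ℝ) + s)) (tab n).1 (tab n).2.1 (tab n).2.2)
    (htabl : ∀ n : ℤ, -(m : ℤ) ≤ n → n ≤ m → (tab n).1.length = Dl + 1)
    {W : ℕ → IPoly} (hW : ∀ i, 1 ≤ i → i < 2 * m →
      TMem S (c / (2 * m)) (fun u ↦ weilArchDensity (((PolyMP.panelCentre (c / (2 * m)) i : ℚ) : ℝ) + u)) (W i))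
    (pw : ℕ → Poly) {mu : ℕ → List MI}
    (hmu : ∀ i, 1 ≤ i → i < 2 * m → ∀ b, b < Dl + 1 →
      MI.mem S (∫ u in (-((c / (2 * m) : ℚ) : ℝ))..((c / (2 * m) : ℚ) : ℝ),
        weilArchDensity (((PolyMP.panelCentre (c / (2 * m)) i : ℚ) : ℝ) + u) * u ^ b) ((mu i).getD b default)) :
    TMem S (c / (2 * m)) (fun ρ ↦ ∫ t in Ioc ((c : ℝ) - ((((PolyMP.panelCentre (c / (2 * m)) k : ℚ) : ℝ) + ρ)))
        ((c : ℝ) + ((((PolyMP.panelCentre (c / (2 * m)) k : ℚ) : ℝ) + ρ))),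
        weilArchDensityG t * ((g (((PolyMP.panelCentre (c / (2 * m)) k : ℚ) : ℝ) + ρ) -
          g (((PolyMP.panelCentre (c / (2 * m)) k : ℚ) : ℝ) + ρ - t)) / t))
      (dt_archHTM S c m k Dl Gy tab mu W pw) := by
  set h : ℚ := c / (2 * m) with hh
  have hm : 0 < m := by omega
  have hk : k < m := by omega
  have hhr : (0 : ℝ) < h := dt_h_pos hc hm
  have hhr' : (0 : ℚ) ≤ h := by
    have : (0 : ℚ) < m := by exact_mod_cast hm
    rw [hh]; positivity
  set y0 : ℝ := ((PolyMP.panelCentre h k : ℚ) : ℝ) with hy0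
  set tI : ℕ → ℝ := fun i ↦ ((PolyMP.panelCentre h i : ℚ) : ℝ) with htI
  set jn := m - 1 - k with hjn
  set jf := m + k with hjf
  have hjn1 : 1 ≤ jn := by omega
  have hjn2 : jn < 2 * m := by omega
  have hjf1 : 1 ≤ jf := by omega
  have hjf2 : jf < 2 * m := by omega
  have hjnjf : jn < jf := by omega
  set K : ℕ → ℝ → ℝ := fun i u ↦ weilArchDensity (tI i + u) with hK
  set m0r : ℕ → ℝ := fun i ↦ ∫ u in (-(h : ℝ))..h, K i u with hm0r
  have hm0 : ∀ i, 1 ≤ i → i < 2 * m → MI.mem S (m0r i) ((mu i).getD 0 default) := by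
    intro i hi1 hi2
    have := hmu i hi1 hi2 0 (by omega)
    simpa [hm0r, hK] using this
  set F : ℝ → ℝ → ℝ := fun ρ t ↦ weilArchDensityG t * ((g (y0 + ρ) - g (y0 + ρ - t)) / t) with hF
  have hFint : ∀ ρ (a b : ℝ), 0 ≤ a → a ≤ b → IntervalIntegrable (F ρ) volume a b := by
    intro ρ a b ha hab
    -- on `Ι a b ⊂ (0, ∞)` the integrand is `G · (polynomial in t)`
    have hpoly : Continuous fun t : ℝ ↦
        ∑ p ∈ Finset.range as0.length, ∑ b ∈ Finset.range (as0.length - p),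
          ρ ^ p * (as0.getD (p + b) 0 * ((p + b).choose p : ℝ)) *
            (if b = 0 then 0 else (-1 : ℝ) ^ (b + 1) * t ^ (b - 1)) := by
      refine continuous_finsetSum _ fun p _ ↦ continuous_finsetSum _ fun b _ ↦ ?_
      by_cases hb : b = 0
      · simp only [hb, if_true, mul_zero]; exact continuous_const
      · simp only [hb, if_false]; exact continuous_const.mul (continuous_const.mul (continuous_pow _))
    refine (intervalIntegrable_weilArchDensityG_mul ha hab hpoly).congr fun t ht ↦ ?_
    have ht0 : 0 < t := by rw [Set.uIoc_of_le hab] at ht; exact lt_of_le_of_lt ha ht.1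
    simp only [hF]
    rw [firstDiff_div_eq_sum hexp0 ρ ht0.ne']
  have hFpanel : ∀ i, 1 ≤ i → ∀ ρ u, -(h : ℝ) ≤ u →
      F ρ (tI i + u) = K i u * (g (y0 + ρ) - g ((y0 - tI i) + (ρ + (-1 : ℤ) * u))) := by
    intro i hi ρ u hu
    have e1 : y0 + ρ - (tI i + u) = (y0 - tI i) + (ρ + ((-1 : ℤ) : ℝ) * u) := by push_cast; ring
    simp only [hF, hK]
    rw [dt_G_mul_div (t := tI i + u) (dt_tI_add_pos hc hm hi hu), e1]
  have htabM : ∀ i, 1 ≤ i → i ≤ m + k →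
      TabOK S (2 * h) (fun s ↦ g ((y0 - tI i) + s)) (tab ((k : ℤ) - i)).1 (tab ((k : ℤ) - i)).2.1 (tab ((k : ℤ) - i)).2.2 ∧
      (tab ((k : ℤ) - i)).1.length = Dl + 1 := by
    intro i hi1 hi2
    have hn1 : -(m : ℤ) ≤ (k : ℤ) - i := by omega
    have hn2 : (k : ℤ) - i ≤ m := by omega
    have e : (fun s ↦ g (2 * (((k : ℤ) - i : ℤ) : ℝ) * (h : ℝ) + s)) = fun s ↦ g ((y0 - tI i) + s) := by
      funext s; rw [dt_base_minus]
    have := htab _ hn1 hn2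
    rw [e] at this
    exact ⟨this, htabl _ hn1 hn2⟩
  have hKi : ∀ i, 1 ≤ i → IntervalIntegrable (K i) volume (-(h : ℝ)) h := fun i hi ↦ dt_intervalIntegrable_K hc hm hi
  have hK0 : ∀ i, 1 ≤ i → ∀ u ∈ Icc (-(h : ℝ)) h, 0 ≤ K i u := fun i hi ↦ dt_K_nonneg hc hm hi
  have hmu' : ∀ i, 1 ≤ i → i < 2 * m → ∀ (L : ℕ), L = Dl + 1 → ∀ b, b < L →
      MI.mem S (∫ u in (-(h : ℝ))..h, K i u * u ^ b) ((mu i).getD b default) := by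
    intro i hi1 hi2 L hL b hb; subst hL; exact hmu i hi1 hi2 b hb
  have hgc : ∀ b0 : ℝ, Continuous fun s ↦ g (b0 + s) := fun b0 ↦ hg.comp (continuous_const.add continuous_id)
  -- (b) full panels `jn ≤ i < jf`
  have hfull : ∀ i, i < jf → jn ≤ i → TMem S h (fun ρ ↦ ∫ u in (-(h : ℝ))..h, F ρ (tI i + u))
      (tsubI (tsmulI S ((mu i).getD 0 default) Gy)
        (widen0 (contrI S (tab ((k : ℤ) - i)).1 (mu i) (-1))
          ⌈(((tab ((k : ℤ) - i)).2.1 * ((mu i).getD 0 default).hi : ℤ) : ℚ) / S⌉)) := by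
    intro i hij hi0
    have hi1 : 1 ≤ i := le_trans hjn1 hi0
    have hi2 : i < 2 * m := by omega
    obtain ⟨hTm, hLm⟩ := htabM i hi1 (by omega)
    have T1 := tmem_smulI hS (hm0 i hi1 hi2) hGy
    have T2 := tmem_contrI hS hhr' le_rfl hTm (hgc _) (hKi i hi1) (hK0 i hi1) (hmu' i hi1 hi2 _ hLm)
      (by omega) (sgn := -1) (Or.inr rfl)
    refine tmem_congr_on (tmem_sub T1 T2) fun ρ hρ ↦ ?_
    have hcongr : ∫ u in (-(h : ℝ))..h, F ρ (tI i + u) = ∫ u in (-(h : ℝ))..h,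
        K i u * (g (y0 + ρ) - g ((y0 - tI i) + (ρ + (-1 : ℤ) * u))) :=
      intervalIntegral.integral_congr fun u hu ↦ hFpanel i hi1 ρ u (by
        rw [Set.uIcc_of_le (by linarith)] at hu; exact hu.1)
    rw [hcongr]
    have hI1 : IntervalIntegrable (fun u ↦ K i u * g (y0 + ρ)) volume (-(h : ℝ)) h := (hKi i hi1).mul_const _
    have hI2 : IntervalIntegrable (fun u ↦ K i u * g ((y0 - tI i) + (ρ + (-1 : ℤ) * u))) volume (-(h : ℝ)) h :=
      intervalIntegrable_kernel_mul (hKi i hi1) ((hgc _).comp (by fun_prop))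
    have esplit : ∫ u in (-(h : ℝ))..h, K i u * (g (y0 + ρ) - g ((y0 - tI i) + (ρ + (-1 : ℤ) * u))) =
        (∫ u in (-(h : ℝ))..h, K i u * g (y0 + ρ)) - ∫ u in (-(h : ℝ))..h, K i u * g ((y0 - tI i) + (ρ + (-1 : ℤ) * u)) := by
      rw [← intervalIntegral.integral_sub hI1 hI2]
      exact intervalIntegral.integral_congr fun u _ ↦ by ring
    rw [esplit, intervalIntegral.integral_mul_const]
  -- (c) fold from the zero model
  have hfold := tmem_foldl_range (S := S) (h := h) (fun i ↦ jn ≤ i) (tmem_zero' S h) jf fun i hi hp ↦ hfull i hi hp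
  -- (d) partial pieces: near (`jn`, `τ = -1`) and far (`jf`, `τ = 1`)
  have hpartial : ∀ j (τ : ℤ), 1 ≤ j → j < 2 * m → j ≤ m + k → (τ = 1 ∨ τ = -1) →
      TMem S h (fun ρ ↦ ∫ u in (-(h : ℝ))..((τ : ℝ) * ρ), F ρ (tI j + u))
        (tsubI (tmulI S h Dl Gy (partConstI S h (W j) (pw j) τ))
          (widen0 (partVarI S h (tab ((k : ℤ) - j)).1 (pw j) (-1) τ)
            ⌈((((tab ((k : ℤ) - j)).2.1 * ((mu j).getD 0 default).hi : ℤ) : ℚ) +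
              2 * h * ((tabsI S h (tsubI (W j) (ratPolyI S (pw j))) * (tab ((k : ℤ) - j)).2.2 : ℤ) : ℚ)) / S⌉)) := by
    intro j τ hj1 hj2 hj3 hτ
    obtain ⟨hTm, hLm⟩ := htabM j hj1 hj3
    have hWj := hW j hj1 hj2
    have hpc : TMem S h (fun ρ ↦ ∫ u in (-(h : ℝ))..((τ : ℝ) * ρ), K j u) (partConstI S h (W j) (pw j) τ) :=
      tmem_partConst hS hhr' (hKi j hj1) hWj (pw j) hτ
    have T1 := tmem_mul hS hhr' Dl hGy hpc
    have T2 := tmem_partVar hS hhr' le_rfl hTm (hgc _) (hKi j hj1) (hK0 j hj1) hWj (pw j) (hm0 j hj1 hj2)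
      (sgn := -1) (τ := τ) (Or.inr rfl) hτ
    refine tmem_congr_on (tmem_sub T1 T2) fun ρ hρ ↦ ?_
    have hρ1 := (abs_le.1 hρ).1
    have hρ2 := (abs_le.1 hρ).2
    have hv1 : -(h : ℝ) ≤ τ * ρ := by rcases hτ with h1 | h1 <;> simp [h1] <;> linarith
    have hv2 : (τ : ℝ) * ρ ≤ h := by rcases hτ with h1 | h1 <;> simp [h1] <;> linarith
    have hcongr : ∫ u in (-(h : ℝ))..((τ : ℝ) * ρ), F ρ (tI j + u) = ∫ u in (-(h : ℝ))..((τ : ℝ) * ρ),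
        K j u * (g (y0 + ρ) - g ((y0 - tI j) + (ρ + (-1 : ℤ) * u))) :=
      intervalIntegral.integral_congr fun u hu ↦ hFpanel j hj1 ρ u (by
        rw [Set.uIcc_of_le hv1] at hu; exact hu.1)
    rw [hcongr]
    have hKsub : IntervalIntegrable (K j) volume (-(h : ℝ)) (τ * ρ) :=
      (hKi j hj1).mono_set (by rw [Set.uIcc_of_le hv1, Set.uIcc_of_le (by linarith)];
                                exact Icc_subset_Icc le_rfl hv2)
    have hI1 : IntervalIntegrable (fun u ↦ K j u * g (y0 + ρ)) volume (-(h : ℝ)) (τ * ρ) := hKsub.mul_const _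
    have hI2 : IntervalIntegrable (fun u ↦ K j u * g ((y0 - tI j) + (ρ + (-1 : ℤ) * u))) volume (-(h : ℝ)) (τ * ρ) :=
      hKsub.mul_continuousOn ((hgc _).comp (by fun_prop)).continuousOn
    have esplit : ∫ u in (-(h : ℝ))..((τ : ℝ) * ρ), K j u * (g (y0 + ρ) - g ((y0 - tI j) + (ρ + (-1 : ℤ) * u))) =
        (∫ u in (-(h : ℝ))..((τ : ℝ) * ρ), K j u * g (y0 + ρ)) -
          ∫ u in (-(h : ℝ))..((τ : ℝ) * ρ), K j u * g ((y0 - tI j) + (ρ + (-1 : ℤ) * u)) := by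
      rw [← intervalIntegral.integral_sub hI1 hI2]
      exact intervalIntegral.integral_congr fun u _ ↦ by ring
    rw [esplit, intervalIntegral.integral_mul_const]
    ring
  have hnear := hpartial jn (-1) hjn1 hjn2 (by omega) (Or.inr rfl)
  have hfar := hpartial jf 1 hjf1 hjf2 le_rfl (Or.inl rfl)
  -- (e) assemble
  refine tmem_congr_on (tmem_add (tmem_sub hfold hnear) hfar) fun ρ hρ ↦ ?_
  have hρ1 := (abs_le.1 hρ).1
  have hρ2 := (abs_le.1 hρ).2
  have hTn : (c : ℝ) - (y0 + ρ) = tI jn - ρ := by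
    simp only [hy0, htI, hjn]; rw [← dt_c_sub_y0 hk]; ring
  have hTf : (c : ℝ) + (y0 + ρ) = tI jf + ρ := by
    simp only [hy0, htI, hjf]; rw [← dt_c_add_y0 (c := c) hm]; ring
  have htIjn : tI jn = (2 * jn + 1) * (h : ℝ) := by simp only [htI]; rw [dt_tI_eq]
  have htIjf : tI jf = (2 * jf + 1) * (h : ℝ) := by simp only [htI]; rw [dt_tI_eq]
  have hjnr : (1 : ℝ) ≤ jn := by exact_mod_cast hjn1
  have hjfr : (jn : ℝ) + 1 ≤ jf := by exact_mod_cast hjnjf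
  have h2jn : (0 : ℝ) ≤ 2 * jn * h := by positivity
  have hA : 2 * jn * (h : ℝ) ≤ tI jn - ρ := by rw [htIjn]; nlinarith
  have hB : tI jn - ρ ≤ 2 * jf * (h : ℝ) := by rw [htIjn]; nlinarith
  have hC : 2 * jf * (h : ℝ) ≤ tI jf + ρ := by rw [htIjf]; nlinarith
  rw [hTn, hTf, ← intervalIntegral.integral_of_le (hB.trans hC)]
  have I1 := hFint ρ (2 * jn * h) (tI jn - ρ) h2jn hA
  have I2 := hFint ρ (tI jn - ρ) (2 * jf * h) (h2jn.trans hA) hB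
  have I3 := hFint ρ (2 * jf * h) (tI jf + ρ) ((h2jn.trans hA).trans hB) hC
  have I4 := hFint ρ 0 (2 * jn * h) le_rfl h2jn
  rw [← intervalIntegral.integral_add_adjacent_intervals I2 I3]
  have e12 : ∫ t in (tI jn - ρ)..(2 * jf * (h : ℝ)), F ρ t =
      (∫ t in (2 * jn * (h : ℝ))..(2 * jf * (h : ℝ)), F ρ t) - ∫ t in (2 * jn * (h : ℝ))..(tI jn - ρ), F ρ t := by
    rw [← intervalIntegral.integral_add_adjacent_intervals I1 I2]; ring
  have e0f : ∫ t in (2 * jn * (h : ℝ))..(2 * jf * (h : ℝ)), F ρ t =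
      (∫ t in (0 : ℝ)..(2 * jf * (h : ℝ)), F ρ t) - ∫ t in (0 : ℝ)..(2 * jn * (h : ℝ)), F ρ t := by
    rw [← intervalIntegral.integral_add_adjacent_intervals I4 (I1.trans I2)]; ring
  rw [e12, e0f, intervalIntegral_eq_sum_panels (F ρ) hhr.le (fun a b ha hab ↦ hFint ρ a b ha hab) jf,
    intervalIntegral_eq_sum_panels (F ρ) hhr.le (fun a b ha hab ↦ hFint ρ a b ha hab) jn,
    ← Finset.sum_Ico_eq_sub _ hjnjf.le]
  have eIco : Finset.Ico jn jf = (Finset.range jf).filter (fun i ↦ jn ≤ i) := by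
    ext i; simp only [Finset.mem_Ico, Finset.mem_filter, Finset.mem_range]; omega
  rw [eIco]
  have emid : ∑ i ∈ (Finset.range jf).filter (fun i ↦ jn ≤ i), ∫ u in (-(h : ℝ))..h, F ρ ((2 * (i : ℝ) + 1) * h + u) =
      ∑ i ∈ (Finset.range jf).filter (fun i ↦ jn ≤ i), ∫ u in (-(h : ℝ))..h, F ρ (tI i + u) := by
    refine Finset.sum_congr rfl fun i _ ↦ ?_
    simp only [htI]; rw [dt_tI_eq]
  have enear : ∫ t in (2 * jn * (h : ℝ))..(tI jn - ρ), F ρ t = ∫ u in (-(h : ℝ))..(((-1 : ℤ) : ℝ) * ρ), F ρ (tI jn + u) := by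
    have := intervalIntegral.integral_comp_add_right (F ρ) (tI jn) (a := -(h : ℝ)) (b := ((-1 : ℤ) : ℝ) * ρ)
    rw [show -(h : ℝ) + tI jn = 2 * jn * h by rw [htIjn]; ring,
      show ((-1 : ℤ) : ℝ) * ρ + tI jn = tI jn - ρ by push_cast; ring] at this
    rw [← this]
    exact intervalIntegral.integral_congr fun u _ ↦ by rw [add_comm]
  have efar : ∫ t in (2 * jf * (h : ℝ))..(tI jf + ρ), F ρ t = ∫ u in (-(h : ℝ))..(((1 : ℤ) : ℝ) * ρ), F ρ (tI jf + u) := by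
    have := intervalIntegral.integral_comp_add_right (F ρ) (tI jf) (a := -(h : ℝ)) (b := ((1 : ℤ) : ℝ) * ρ)
    rw [show -(h : ℝ) + tI jf = 2 * jf * h by rw [htIjf]; ring,
      show ((1 : ℤ) : ℝ) * ρ + tI jf = tI jf + ρ by push_cast; ring] at this
    rw [← this]
    exact intervalIntegral.integral_congr fun u _ ↦ by rw [add_comm]
  rw [emid, enear, efar]
  ring

end ArchH

end Summit.RiemannHypothesis.RiemannHypothesis.Theorems.EvenWinsBeyondArch

end
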